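import Literature.Geometry.Riemannian.DistanceSmoothOffCutLocus
import Literature.Geometry.Riemannian.ExpMapLocalDiffeo
import HarnessLib

/-!
# The squared distance is smooth at the base point

On a connected complete Riemannian manifold, `z ↦ d(q, z)²` is `C^∞` at `z = q` (and off
`Cut(q)` by `DistanceSmoothOffCutLocus.lean`): near `q`, `d(q, exp_q v)² = g_q(v, v)`
(`edist_expMap_eq_of_mem_injectivityDomain`, `v` in the injectivity domain, an open
neighbourhood of `0`) and `exp_q` is a local diffeomorphism at `0`
(`isLocalDiffeomorphAt_expMap_zero_of_le`), so `d(q, ·)² = g_q(exp_q⁻¹ ·, exp_q⁻¹ ·)` near `q`.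
Lee 2018, Lemma 6.8 / proof of Prop. 6.11 (the radial distance function `r = |exp_p⁻¹|_g` on a
normal neighbourhood; `r²` is smooth). We PROVE `eventuallyEq_edist_sq_val_localInverse` and
`contMDiffAt_edist_sq_self`. No definitions, no named facts (D-0026). Groundwork for
`CheegerColding1997_sphereStability` (smooth comparison / bump functions built from `d²`).

## References

* J. M. Lee, *Introduction to Riemannian Manifolds* (2018), Lemma 6.8, Prop. 6.11, Cor. 6.12.
  [LeeRiemannianManifolds2018]
-/

noncomputable section

open Bundle Set Function Filter
open scoped Manifold ContDiff Topology ENNReal NNReal Real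

namespace Literature.Geometry.Riemannian

open Lorentzian Lorentzian.PseudoRiemannianMetric

variable {E : Type*} [NormedAddCommGroup E] [NormedSpace ℝ E] [FiniteDimensional ℝ E]
  [CompleteSpace E] {M : Type*} [TopologicalSpace M] [ChartedSpace E M] [IsManifold 𝓘(ℝ, E) ∞ M]
  [T2Space M]
  (g : PseudoRiemannianMetric 𝓘(ℝ, E) ∞ E (TangentSpace 𝓘(ℝ, E) : M → Type _)) [g.HasLeviCivita]
  [CovariantDerivative.ContMDiffCovariantDerivative g.leviCivita 1]
  [CovariantDerivative.ContMDiffCovariantDerivative g.leviCivita ∞]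

/-- **The squared distance from `q` is `C^∞` at `q`** (Lee 2018, Lemma 6.8 / Prop. 6.11: on a
normal neighbourhood `r² = |exp_q⁻¹(·)|²_g` is smooth): on a connected Riemannian manifold with
complete Levi-Civita connection, `z ↦ d(q, z)²` is `C^∞` at `z = q`, and near `q` it equals
`g_q(ψ z, ψ z)` for a local inverse `ψ` of `exp_q` at `0`.
[cite: LeeRiemannianManifolds2018, Lemma 6.8, Prop. 6.11] -/
theorem contMDiffAt_edist_sq_self [ConnectedSpace M] (hg : g.IsRiemannian)
    (hc : IsGeodesicallyComplete g.leviCivita) (q : M) :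
    ContMDiffAt 𝓘(ℝ, E) 𝓘(ℝ, ℝ) ∞ (fun z ↦ (g.edist hg q z).toReal ^ 2) q := by
  -- `exp_q` as a map `E → M`, a local diffeomorphism at `0`
  set F : E → M := fun v ↦ expMap g.leviCivita q (show TangentSpace 𝓘(ℝ, E) q from v) with hF
  have hFd : IsLocalDiffeomorphAt 𝓘(ℝ, E) 𝓘(ℝ, E) (⊤ : ℕ∞) F 0 :=
    isLocalDiffeomorphAt_expMap_zero_of_le (cov := g.leviCivita) (k := (⊤ : ℕ∞)) le_top q
  set ψ := hFd.localInverse with hψ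
  have hF0 : F 0 = q := expMap_zero (cov := g.leviCivita) q
  have hSo : IsOpen ψ.source := hFd.localInverse_open_source
  have hqS : q ∈ ψ.source := by rw [← hF0]; exact hFd.localInverse_mem_source
  have hψq : ψ q = 0 := by
    have h := hFd.localInverse_left_inv hFd.localInverse_mem_target
    rwa [hF0] at h
  have hψsm : ContMDiffOn 𝓘(ℝ, E) 𝓘(ℝ, E) ∞ ψ ψ.source := hFd.contmdiffOn_localInverse
  have hψat : ContMDiffAt 𝓘(ℝ, E) 𝓘(ℝ, E) ∞ ψ q := hψsm.contMDiffAt (hSo.mem_nhds hqS)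
  -- near `q`, `ψ z` lies in the injectivity domain
  have hID : IsOpen {v : E | (show TangentSpace 𝓘(ℝ, E) q from v) ∈ injectivityDomain g hg q} :=
    isOpen_injectivityDomain_of_isGeodesicallyComplete g le_rfl hg hc q
  have h0ID : (0 : E) ∈ {v : E | (show TangentSpace 𝓘(ℝ, E) q from v) ∈ injectivityDomain g hg q} :=
    zero_mem_injectivityDomain hg q
  have hev : ∀ᶠ z in 𝓝 q, z ∈ ψ.source ∧
      (show TangentSpace 𝓘(ℝ, E) q from ψ z) ∈ injectivityDomain g hg q := by
    have h1 : ∀ᶠ z in 𝓝 q, z ∈ ψ.source := hSo.mem_nhds hqS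
    have h2 : ∀ᶠ z in 𝓝 q, ψ z ∈ {v : E | (show TangentSpace 𝓘(ℝ, E) q from v) ∈
        injectivityDomain g hg q} := by
      refine hψat.continuousAt.preimage_mem_nhds ?_
      rw [hψq]; exact hID.mem_nhds h0ID
    exact h1.and h2
  -- the formula `d(q, z)² = g_q(ψ z, ψ z)` near `q`
  have hformula : (fun z ↦ (g.edist hg q z).toReal ^ 2) =ᶠ[𝓝 q]
      fun z ↦ g.val q (show TangentSpace 𝓘(ℝ, E) q from ψ z) (show TangentSpace 𝓘(ℝ, E) q from ψ z) := by
    filter_upwards [hev] with z hz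
    obtain ⟨hzS, hzID⟩ := hz
    have h1 := edist_expMap_eq_of_mem_injectivityDomain g hg hc q hzID
    have h2 : expMap g.leviCivita q (show TangentSpace 𝓘(ℝ, E) q from ψ z) = z :=
      hFd.localInverse_right_inv hzS
    rw [h2] at h1
    show (g.edist hg q z).toReal ^ 2 = _
    rw [h1, ENNReal.toReal_ofReal (Real.sqrt_nonneg _), Real.sq_sqrt]
    by_cases h0 : (show TangentSpace 𝓘(ℝ, E) q from ψ z) = 0
    · rw [h0]; simp
    · exact (hg q _ h0).le
  -- smoothness of `z ↦ g_q(ψ z, ψ z)`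
  have hG : ContDiff ℝ ∞ fun v : E ↦ g.val q (show TangentSpace 𝓘(ℝ, E) q from v)
      (show TangentSpace 𝓘(ℝ, E) q from v) := by
    set B : E →L[ℝ] E →L[ℝ] ℝ := (show E →L[ℝ] E →L[ℝ] ℝ from g.val q) with hB
    have h1 : ContDiff ℝ ∞ fun v : E ↦ B v v :=
      B.isBoundedBilinearMap.contDiff.comp (contDiff_id.prodMk contDiff_id)
    exact h1
  have hcomp : ContMDiffAt 𝓘(ℝ, E) 𝓘(ℝ, ℝ) ∞
      (fun z ↦ g.val q (show TangentSpace 𝓘(ℝ, E) q from ψ z) (show TangentSpace 𝓘(ℝ, E) q from ψ z)) q :=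
    hG.contMDiff.contMDiffAt.comp q hψat
  exact hcomp.congr_of_eventuallyEq hformula

end Literature.Geometry.Riemannian

end
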